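import Literature.AlgebraicGeometry.Frobenioids.PadicFieldwiseSaturatedPrelim
import HarnessLib

/-!
# Frobenioids II, Theorem 2.4 (i), proof p. 20 ll. 9–22: the «easily verified» characterisation of fieldwise
# saturated `p`-adic Frobenioids — (a) divisibility of `lim Φ(B)` and (b) Galois descent of `O^⊳` (PROOFS)

Mochizuki, *The geometry of Frobenioids II*, Kyushu J. Math. **62** (2008) 401–460, §2, proof of Theorem 2.4 (i),
p. 417 of the journal = p. 20 of the author's text [cite: MochizukiFrdII2008, Thm 2.4 (i) p.20]:

> "We begin by observing the (easily verified) fact that `Φᵢ` is fieldwise saturated if and only if the following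
> two conditions hold. (a) The inductive limit monoid `lim_→ Φᵢ(B)` (where `B` ranges over the objects of `Dᵢ`)
> is divisible. (b) For every pull-back morphism `φ : B → C` of `Cᵢ` that projects to a Galois covering
> `φ_D : B_D → C_D` of `Dᵢ`, the injection `O^⊳(C) → O^⊳(B)` induced by `φ` (cf. [Mzk5, Proposition 1.11(iv)])
> determines a bijection `O^⊳(C) ⥲ O^⊳(B)^{Gal(B/C)}` (where … `Gal(B/C) := Gal(B_D/C_D)`)."

PROOF-ONLY file (abc-iut cell, seat abc-iut-w5-d229; SUBDAG-FrdII-Thm24 row **L01 `FsCharacterization`**; no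
definitions), over abc-iut-L1-t4's `PadicFrd.Datum` (`Datum.IsFieldwiseSaturated`, PadicFrobenioid.lean) and the
preliminaries `PadicFieldwiseSaturatedPrelim.lean`.

**How (a), (b) are typed — over the DATA `(D, Φ, B, Div_B)` of the model Frobenioid, so that they transport along the
[FrdI] Cor. 4.10 / 4.11 (ii)(iii) comparison isomorphisms (`PadicFieldwiseSaturatedTransport.lean`, row L03 `hfs`).**
(a) = "every element of every `Φ(C)` acquires an `n`-th root in some `Φ(B)`, `B → C`" (the colimit is the directed
union: the pull-backs `Φ(C) → Φ(B)` are injective, abc-iut-L1-d10 `map_Φ_injective`, and `End_D(B)` acts trivially,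
`Datum.endTrivial`). (b): for an object `A = (A_D, α)` of the model Frobenioid, `O^⊳(A)` = the base-identity linear
endomorphisms = `{b ∈ B(A_D) | Div_B b ∈ Φ(A_D) effective}` and the injection of [FrdI] Prop. 1.11 (iv) along a
pull-back morphism over `f : B_D → C_D` is the pull-back `B(f)` (abc-iut-L1-d10 `exists_end_of_divB_eq_one`,
abc-iut-L1-d8 `ModelFrobenioidAutAction`); `Gal(B_D/C_D)` acts through `B(σ)`, `σ` ranging over the endomorphisms
of `B_D` over `C_D`. Accordingly (b) is typed as: for `f` Galois, every EFFECTIVE `b ∈ B(B_D)` fixed by all `B(σ)`,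
`σ ≫ f = f`, is `B(f) c` for an EFFECTIVE `c ∈ B(C_D)` (injectivity of `B(f)` being d10's `map_B_injective`). The
class of Galois coverings of the base is a PARAMETER `Gal` (at the binding: the Galois objects of
`B^temp(Π, Π°)⁰`, Ex. 1.3 (iii)).

**Base hypotheses.** The equivalence is FALSE over an arbitrary base `D → D₀` admitted by `PadicFrd.Datum` (a base
with one object over `ℚ_p` and `Φ = Φ₀` is fieldwise saturated while (a) fails); print's base is
`D = B^temp(Π, Π°)⁰ → B^temp(G_K, G_K°)⁰` (§2, p. 17). The three properties of that base the printed argument uses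
are carried as explicit binders (each an arithmetic statement about `(D, base)`, dischargeable for the
Galois-correspondence base of `QuasiTemperoidGaloisPadicFields.lean`; not asserted here):
`hdom` — every `B₁ → C` is dominated by a Galois `B → C` (Galois closure); `hfix` — for Galois `f : B → C` the
subfield of `K_B` fixed by the endomorphisms of `B` over `C` is the image of `K_C` (Galois theory); `hram` — over
every `C` and for every `N ≥ 1` there is `B → C` along which every class of `ord(O_{K_C}^⊳)` becomes an `N`-th power
(totally ramified extensions of every degree).

* `isFieldwiseSaturated_of_divisible_of_descent` — **(a) ∧ (b) ⇒ fieldwise saturated** (uses `hdom`);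
* `descent_of_isFieldwiseSaturated` — **fieldwise saturated ⇒ (b)** (uses `hfix`);
* `divisible_of_isFieldwiseSaturated` — **fieldwise saturated ⇒ (a)** (uses `hram`);
* `isFieldwiseSaturated_iff_divisible_and_descent` — the printed equivalence.
Classical; nothing here bears on [IUTchIII] Cor. 3.12; no statement of the paper is strengthened (the typed (b)
quantifies over endomorphisms over `C`, which in `B^temp(Π, Π°)⁰` are the elements of `Gal(B_D/C_D)`).
-/

noncomputable section

namespace Literature.AlgebraicGeometry.Frobenioids

open CategoryTheory Opposite Function

universe v u

namespace PadicFrd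

namespace Datum

variable {D : Type u} [Category.{v} D] {p : ℕ} [Fact p.Prime] (d : Datum D p)

/-! ### (a) ∧ (b) ⇒ fieldwise saturated -/

/-- **The mechanism of «(a) ∧ (b) ⇒ fieldwise saturated» at one object `C`** ([FrdII] Thm. 2.4 (i), proof p. 20),
isolated so that it can be run again «in the image of `Ψ^Base`» for the transport of row L03: given a uniformizer `π`
of `K_C`, an effective class `[μ] = ord(π)^m` (`m ≥ 1`), an arrow `f : B → C` of `D` and an `m`-th root `y ∈ Φ(B)` of
`Φ(f) μ`, and DESCENT ALONG `f` for effective elements of `B(B)` fixed by the endomorphisms of `B` over `C`, one has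
`ord(K_C^×) ⊆ Φ(C)^gp`. PROOF. `Φ₀(B)^gp` is torsion-free, so `[ι y] = ord(π)|_B`; the element `b ∈ B(B)` over
`(π ∈ K_B^×, [y])` exists (cartesian square), is effective, and is fixed by every `σ` over `C` (`σ` fixes
`K_C ⊆ K_B` pointwise; `End_D(B)` acts trivially on `Φ(B)`); descend `b = B(f) c`, `Div_B c = [z]`; comparing
`K^×`-components `c` lies over `π`, whence `ord(π) = Div₀(π) = ι^gp Div_B c = [ι z]`. [cite: MochizukiFrdII2008, Thm 2.4 (i) p.20] -/
theorem ordUnitsSubgroup_le_of_root_of_descent (C : D) {π : intNonzero (d.fld C)}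
    (hπ : ∀ a : OrdInt (d.fld C), ∃ k : ℕ, a = Associates.mk π ^ k) {m : ℕ} (hm : 0 < m) {μ : d.Φ.obj (op C)}
    (hμ : d.ordIntGp C (Associates.mk π) ^ m = d.phiGp C μ) {B : D} (f : B ⟶ C) {y : d.Φ.obj (op B)}
    (hy : y ^ m = (d.Φ.map f.op).hom μ)
    (hdesc : ∀ b : d.B.obj (op B),
      (∃ y' : d.Φ.obj (op B), Frobenioids.divB d.Φ d.B d.divB (op B) b = Algebra.GrothendieckGroup.of y') →
      (∀ σ : B ⟶ B, σ ≫ f = f → (d.B.map σ.op).hom b = b) →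
      ∃ c : d.B.obj (op C),
        (∃ z : d.Φ.obj (op C), Frobenioids.divB d.Φ d.B d.divB (op C) c = Algebra.GrothendieckGroup.of z) ∧
        (d.B.map f.op).hom c = b) :
    d.ordUnitsSubgroup C ≤ Subgroup.closure (Set.range (d.phiGp C)) := by
  -- `[y] = ord(π)|_B` in `Φ₀(B)^gp`
  set πu : (d.fld C)ˣ := intNonzeroToUnits (d.fld C) π with hπu
  have hg : d.ordIntGp C (Associates.mk π) = divZeroHom (d.fld C) πu := d.ordIntGp_mk_eq_divZeroHom C π
  have hTy : d.phiGp B y = MonGp.map ((phiZeroOn d.base).map f.op).hom (d.ordIntGp C (Associates.mk π)) := by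
    apply d.gp_eq_of_pow_eq B hm
    rw [← map_pow, hy, ← d.phiZeroGp_phiGp f μ, ← hμ, d.phiZeroGp_map_pow f]
    rfl
  have hTx : MonGp.map ((phiZeroOn d.base).map f.op).hom (d.ordIntGp C (Associates.mk π)) =
      divZeroHom (d.fld B) (Units.map ((d.base.map f).alg : d.fld C →* d.fld B) πu) := by
    rw [hg, d.phiZeroGp_divZeroHom f πu]
  -- the element `b ∈ B(B)` over `(π|_{K_B}, [y])`
  obtain ⟨b, hb0, hbd⟩ := d.exists_B_of_compat (op B)
    (Units.map ((d.base.map f).alg : d.fld C →* d.fld B) πu) (Algebra.GrothendieckGroup.of y) (by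
      rw [← hTx, ← hTy, MonGp.map_of]; rfl)
  -- `b` is fixed by every endomorphism of `B` over `C`
  have hinv : ∀ σ : B ⟶ B, σ ≫ f = f → (d.B.map σ.op).hom b = b := by
    intro σ hσ
    apply d.B_ext (op B)
    · change d.resK B ((d.B.map σ.op).hom b) = d.resK B b
      rw [d.resK_mapB σ b]
      change Units.map _ ((d.toB0.app (op B)).hom b) = (d.toB0.app (op B)).hom b
      rw [hb0]
      ext
      change (d.base.map σ).alg ((d.base.map f).alg (π : d.fld C)) = (d.base.map f).alg (π : d.fld C)
      exact d.alg_baseMap_over f σ hσ _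
    · rw [d.divB_mapB σ b, d.pullGp_endo σ]
  -- descend `b` to an effective `c ∈ B(C)`
  obtain ⟨c, ⟨z, hcz⟩, hcb⟩ := hdesc b ⟨y, hbd⟩ hinv
  -- `c` lies over `π`
  have hc0 : d.resK C c = πu := by
    have h1 : d.resK B ((d.B.map f.op).hom c) = Units.map ((d.base.map f).alg : d.fld C →* d.fld B) (d.resK C c) :=
      d.resK_mapB f c
    rw [hcb] at h1
    change (d.toB0.app (op B)).hom b = _ at h1
    rw [hb0] at h1
    exact (Units.map_injective (f := ((d.base.map f).alg : d.fld C →* d.fld B)) (d.base.map f).alg.injective h1).symm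
  -- hence `ord(π) = Div₀(π) = ι^gp Div_B(c) = [ι z]`
  have hgen : d.phiGp C z = d.ordIntGp C (Associates.mk π) := by
    rw [hg, ← hc0, d.divZeroHom_resK C c, hcz, ← d.phiGp_eq_monGp_map_of]
  exact d.ordUnitsSubgroup_le_of_phiGp_eq C hπ hgen

/-- **[FrdII] Thm. 2.4 (i), proof p. 20, «(a) ∧ (b) ⇒ `Φ` fieldwise saturated»** (for any class `Gal` of Galois
coverings of the base such that every arrow `B₁ → C` is dominated by a Galois `B → C`). PROOF. Fix `C` and a
uniformizer `π` of `K_C`; some `ord(π)^m`, `m ≥ 1`, is an effective class `[μ]` of `Φ(C)` (`Div_B` nonzero). By (a)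
and `hdom`, `μ` has an `m`-th root `y ∈ Φ(B)` over a Galois `f : B → C`; conclude by
`ordUnitsSubgroup_le_of_root_of_descent` with (b) along `f`. [cite: MochizukiFrdII2008, Thm 2.4 (i) p.20] -/
theorem isFieldwiseSaturated_of_divisible_of_descent (Gal : ∀ ⦃B C : D⦄, (B ⟶ C) → Prop)
    (hdom : ∀ ⦃B₁ C : D⦄ (f₁ : B₁ ⟶ C), ∃ (B : D) (g : B ⟶ B₁), Gal (g ≫ f₁))
    (hdiv : ∀ (C : D) (x : d.Φ.obj (op C)) (n : ℕ), 0 < n →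
      ∃ (B : D) (f : B ⟶ C) (y : d.Φ.obj (op B)), y ^ n = (d.Φ.map f.op).hom x)
    (hdesc : ∀ ⦃B C : D⦄ (f : B ⟶ C), Gal f → ∀ b : d.B.obj (op B),
      (∃ y : d.Φ.obj (op B), Frobenioids.divB d.Φ d.B d.divB (op B) b = Algebra.GrothendieckGroup.of y) →
      (∀ σ : B ⟶ B, σ ≫ f = f → (d.B.map σ.op).hom b = b) →
      ∃ c : d.B.obj (op C),
        (∃ z : d.Φ.obj (op C), Frobenioids.divB d.Φ d.B d.divB (op C) c = Algebra.GrothendieckGroup.of z) ∧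
        (d.B.map f.op).hom c = b) :
    d.IsFieldwiseSaturated := by
  intro C
  obtain ⟨π, -, hπ⟩ := d.exists_uniformizer C
  -- some positive multiple of `ord(π)` is effective in `Φ(C)`
  obtain ⟨m, μ, hm, hμ⟩ := d.exists_pow_generator_eq_phiGp C hπ
  -- (a): an `m`-th root over some `B₁ → C`; `hdom`: dominate by a Galois `f : B → C`
  obtain ⟨B₁, f₁, y₁, hy₁⟩ := hdiv C μ m hm
  obtain ⟨B, g, hgal⟩ := hdom f₁
  have hy : ((d.Φ.map g.op).hom y₁) ^ m = (d.Φ.map (g ≫ f₁).op).hom μ := by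
    rw [← map_pow, hy₁, op_comp, d.Φ.map_comp, CommMonCat.comp_apply]
  exact d.ordUnitsSubgroup_le_of_root_of_descent C hπ hm hμ (g ≫ f₁) hy (hdesc (g ≫ f₁) hgal)

/-! ### fieldwise saturated ⇒ (b) -/

/-- **[FrdII] Thm. 2.4 (i), proof p. 20, «fieldwise saturated ⇒ (b)»**, given Galois theory of the base (`hfix`: for a
Galois `f : B → C` the elements of `K_B` fixed by all endomorphisms of `B` over `C` come from `K_C`). PROOF. Let
`b ∈ B(B)` be effective and `Gal`-fixed, `x := b|_{K_B^×}`. Then `x` is fixed, so `x = x₀|_{K_B}` with `x₀ ∈ K_C^×`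
(`hfix`). Write `Div₀(x₀) = ord(π_C)^k` (`k ∈ ℤ`); by saturation `ord(π_C) = [ι c₀]` with `c₀ ∈ Φ(C)`, and `k ≥ 0`
since `Div₀(x) = ι^gp Div_B(b)` is effective while `[ι Φ(f)c₀]` is a non-trivial effective class (sharpness). The
element `c ∈ B(C)` over `(x₀, [c₀^k])` is effective and `B(f) c = b` (compare both components; `ι^gp` is injective).
[cite: MochizukiFrdII2008, Thm 2.4 (i) p.20] -/
theorem descent_of_isFieldwiseSaturated (hfs : d.IsFieldwiseSaturated) (Gal : ∀ ⦃B C : D⦄, (B ⟶ C) → Prop)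
    (hfix : ∀ ⦃B C : D⦄ (f : B ⟶ C), Gal f → ∀ x : d.fld B,
      (∀ σ : B ⟶ B, σ ≫ f = f → (d.base.map σ).alg x = x) → ∃ x₀ : d.fld C, (d.base.map f).alg x₀ = x)
    ⦃B C : D⦄ (f : B ⟶ C) (hgal : Gal f) (b : d.B.obj (op B))
    (hb : ∃ y : d.Φ.obj (op B), Frobenioids.divB d.Φ d.B d.divB (op B) b = Algebra.GrothendieckGroup.of y)
    (hinv : ∀ σ : B ⟶ B, σ ≫ f = f → (d.B.map σ.op).hom b = b) :
    ∃ c : d.B.obj (op C),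
      (∃ z : d.Φ.obj (op C), Frobenioids.divB d.Φ d.B d.divB (op C) c = Algebra.GrothendieckGroup.of z) ∧
      (d.B.map f.op).hom c = b := by
  obtain ⟨y, hy⟩ := hb
  set x : (d.fld B)ˣ := d.resK B b with hx
  -- `x` is fixed by the endomorphisms over `C`, hence comes from `K_C`
  have hxfix : ∀ σ : B ⟶ B, σ ≫ f = f → (d.base.map σ).alg (x : d.fld B) = x := by
    intro σ hσ
    have h1 : d.resK B ((d.B.map σ.op).hom b) = d.resK B b := by rw [hinv σ hσ]
    rw [d.resK_mapB σ b] at h1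
    exact congrArg Units.val h1
  obtain ⟨x₀, hx₀⟩ := hfix f hgal (x : d.fld B) hxfix
  have hx₀0 : x₀ ≠ 0 := by
    rintro rfl
    rw [map_zero] at hx₀
    exact x.ne_zero hx₀.symm
  set x₀u : (d.fld C)ˣ := Units.mk0 x₀ hx₀0 with hx₀u
  have hx₀x : Units.map ((d.base.map f).alg : d.fld C →* d.fld B) x₀u = x := Units.ext hx₀
  -- uniformizer and effective generator at `C`
  obtain ⟨π, hπ1, hπ⟩ := d.exists_uniformizer C
  obtain ⟨c₀, hc₀⟩ := d.exists_phiGp_eq_generator hfs C hπ1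
  obtain ⟨k, hk⟩ := d.exists_zpow_eq_of_mem_ordUnitsSubgroup C hπ (d.divZeroHom_mem_ordUnitsSubgroup C x₀u)
  -- `Div₀(x) = ι^gp Div_B(b) = [ι y]` and `= Φ₀^gp(f)(ord(π)^k) = [ι Φ(f) c₀]^k`
  have hxy : divZeroHom (d.fld B) x = d.phiGp B y := by
    rw [hx, d.divZeroHom_resK B b, hy, ← d.phiGp_eq_monGp_map_of]
  have hkey : d.phiGp B y = d.phiGp B ((d.Φ.map f.op).hom c₀) ^ k := by
    rw [← hxy, ← hx₀x, d.phiZeroGp_divZeroHom f x₀u, hk, d.phiZeroGp_map_zpow f, ← hc₀, d.phiZeroGp_phiGp f c₀]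
    rfl
  -- the exponent is non-negative
  have hk0 : 0 ≤ k := by
    by_contra hneg
    replace hneg : k < 0 := lt_of_not_ge hneg
    have h1 : d.phiGp B (((d.Φ.map f.op).hom c₀) ^ (-k).toNat) * d.phiGp B y = 1 := by
      rw [hkey, map_pow, ← zpow_natCast, Int.toNat_of_nonneg (by omega), ← zpow_add, neg_add_cancel, zpow_zero]
    have h2 : ((d.Φ.map f.op).hom c₀) ^ (-k).toNat = 1 := d.eq_one_of_phiGp_mul_phiGp_eq_one B _ _ h1
    have h3 : (d.Φ.map f.op).hom c₀ = 1 :=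
      (d.isMonoprime (op B)).isSharp.isTorsionFree.eq_one_of_pow_eq_one _ _ (by omega) h2
    have h4 : c₀ = 1 := d.map_Φ_injective f (by rw [h3, map_one])
    rw [h4, map_one] at hc₀
    exact hπ1 (d.ordIntGp_injective C (by rw [← hc₀, map_one]))
  have hkn : k = ((k.toNat : ℕ) : ℤ) := (Int.toNat_of_nonneg hk0).symm
  -- the descended element `c ∈ B(C)` over `(x₀, [c₀ ^ k])`
  obtain ⟨c, hcx, hcd⟩ := d.exists_B_of_compat (op C) x₀u (Algebra.GrothendieckGroup.of (c₀ ^ k.toNat)) (by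
    rw [MonGp.map_of, hk]
    conv_lhs => rw [hkn, zpow_natCast, ← hc₀, ← map_pow]
    rfl)
  refine ⟨c, ⟨c₀ ^ k.toNat, hcd⟩, d.B_ext (op B) ?_ ?_⟩
  · change d.resK B ((d.B.map f.op).hom c) = d.resK B b
    rw [d.resK_mapB f c]
    change Units.map _ ((d.toB0.app (op C)).hom c) = x
    rw [hcx]
    exact hx₀x
  · rw [d.divB_mapB f c, hcd, pullGp_of, hy]
    congr 1
    apply d.phiGp_injective B
    rw [map_pow, map_pow]
    conv_rhs => rw [hkey, hkn, zpow_natCast]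

/-! ### fieldwise saturated ⇒ (a) -/

/-- **[FrdII] Thm. 2.4 (i), proof p. 20, «fieldwise saturated ⇒ (a)»**, given enough ramification in the base
(`hram`: over every `C` and for every `N ≥ 1` some `B → C` makes every class of `ord(O_{K_C}^⊳)` an `N`-th power in
`ord(O_{K_B}^⊳)`). PROOF. If `Φ(C)` is `ℚ`- or `ℝ`-monoprime it is divisible already. If `Φ(C) ≅ ℤ_{≥0}` with
generator `μ`, saturation gives `ord(π_C) = [ι c₀]`, `c₀ = μ^k`, `k ≥ 1`; along `f : B → C` with `[π_C] ↦ β^{nk}`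
one gets `[ι Φ(f)μ]^k = (β ⊗ 1)^{nk}`, so `[ι Φ(f)μ] = (β ⊗ 1)^n` (torsion-freeness), and `β ⊗ 1 = [ι c₁^s]` by
saturation at `B`; hence `Φ(f) μ = (c₁^s)^n` and `Φ(f)(μ^j) = ((c₁^s)^j)^n`. [cite: MochizukiFrdII2008, Thm 2.4 (i) p.20] -/
theorem divisible_of_isFieldwiseSaturated (hfs : d.IsFieldwiseSaturated)
    (hram : ∀ (C : D) (N : ℕ), 0 < N → ∃ (B : D) (f : B ⟶ C), ∀ a : OrdInt (d.fld C),
      ∃ b : OrdInt (d.fld B), ordIntMapOfHom (d.base.map f).alg (d.base.map f).isValHom a = b ^ N)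
    (C : D) (x : d.Φ.obj (op C)) (n : ℕ) (hn : 0 < n) :
    ∃ (B : D) (f : B ⟶ C) (y : d.Φ.obj (op B)), y ^ n = (d.Φ.map f.op).hom x := by
  have hid : (d.Φ.map (𝟙 C).op).hom x = x := by
    rw [op_id, d.Φ.map_id, CommMonCat.id_apply]
  rcases d.isMonoprime (op C) with ⟨⟨⟨e⟩⟩⟩ | ⟨⟨⟨e⟩⟩⟩ | ⟨⟨⟨e⟩⟩⟩
  · -- `Φ(C) ≅ ℤ_{≥0}`
    set μ : d.Φ.obj (op C) := e.symm (Multiplicative.ofAdd 1) with hμ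
    have hpow : ∀ c : d.Φ.obj (op C), c = μ ^ Multiplicative.toAdd (e c) := fun c => by
      apply e.injective
      rw [map_pow, hμ, MulEquiv.apply_symm_apply, ← ofAdd_nsmul, smul_eq_mul, mul_one, ofAdd_toAdd]
    obtain ⟨π, hπ1, hπ⟩ := d.exists_uniformizer C
    obtain ⟨c₀, hc₀⟩ := d.exists_phiGp_eq_generator hfs C hπ1
    set k : ℕ := Multiplicative.toAdd (e c₀) with hk
    have hc₀μ : c₀ = μ ^ k := hpow c₀
    have hk0 : 0 < k := by
      rcases Nat.eq_zero_or_pos k with h0 | h0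
      · exfalso
        rw [h0, pow_zero] at hc₀μ
        rw [hc₀μ, map_one] at hc₀
        exact hπ1 (d.ordIntGp_injective C (by rw [← hc₀, map_one]))
      · exact h0
    obtain ⟨B, f, hf⟩ := hram C (n * k) (Nat.mul_pos hn hk0)
    obtain ⟨β, hβ⟩ := hf (Associates.mk π)
    -- `[ι Φ(f) μ]^k = (β ⊗ 1)^(n k)`
    have h1 : d.phiGp B ((d.Φ.map f.op).hom μ) ^ k = (d.ordIntGp B β ^ n) ^ k := by
      rw [← pow_mul, ← map_pow (d.ordIntGp B) β, ← hβ, ← d.phiZeroGp_ordIntGp f, ← hc₀, d.phiZeroGp_phiGp f c₀, hc₀μ, map_pow,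
        map_pow]
    have h2 : d.phiGp B ((d.Φ.map f.op).hom μ) = d.ordIntGp B β ^ n := d.gp_eq_of_pow_eq B hk0 h1
    -- saturation at `B`: `β ⊗ 1 = [ι c₁ ^ s]`
    obtain ⟨πB, hπB1, hπB⟩ := d.exists_uniformizer B
    obtain ⟨c₁, hc₁⟩ := d.exists_phiGp_eq_generator hfs B hπB1
    obtain ⟨s, hs⟩ := hπB β
    have h3 : (d.Φ.map f.op).hom μ = (c₁ ^ s) ^ n := by
      apply d.phiGp_injective B
      rw [h2, hs, map_pow, ← hc₁, ← map_pow, ← map_pow]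
    set j : ℕ := Multiplicative.toAdd (e x) with hj
    have hxj : x = μ ^ j := hpow x
    refine ⟨B, f, (c₁ ^ s) ^ j, ?_⟩
    rw [hxj, map_pow, h3]
    simp only [← pow_mul]
    congr 1
    ring
  · -- `Φ(C) ≅ ℚ_{≥0}`: divisible on the nose
    refine ⟨C, 𝟙 C, e.symm (Multiplicative.ofAdd (Multiplicative.toAdd (e x) / n)), ?_⟩
    rw [hid, ← map_pow, ← ofAdd_nsmul, nsmul_eq_mul, mul_div_assoc', mul_div_cancel_left₀ _ (by exact_mod_cast hn.ne'),
      ofAdd_toAdd, MulEquiv.symm_apply_apply]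
  · -- `Φ(C) ≅ ℝ_{≥0}`: divisible on the nose
    refine ⟨C, 𝟙 C, e.symm (Multiplicative.ofAdd (Multiplicative.toAdd (e x) / n)), ?_⟩
    rw [hid, ← map_pow, ← ofAdd_nsmul, nsmul_eq_mul, mul_div_assoc', mul_div_cancel_left₀ _ (by exact_mod_cast hn.ne'),
      ofAdd_toAdd, MulEquiv.symm_apply_apply]

/-! ### The printed equivalence -/

/-- **[FrdII] Thm. 2.4 (i), proof p. 20: «`Φ` is fieldwise saturated if and only if (a) and (b) hold»**, over a base
with Galois closures (`hdom`), Galois theory (`hfix`) and ramified covers of every index (`hram`) — as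
`B^temp(Π, Π°)⁰ → B^temp(G_K, G_K°)⁰`. [cite: MochizukiFrdII2008, Thm 2.4 (i) p.20] -/
theorem isFieldwiseSaturated_iff_divisible_and_descent (Gal : ∀ ⦃B C : D⦄, (B ⟶ C) → Prop)
    (hdom : ∀ ⦃B₁ C : D⦄ (f₁ : B₁ ⟶ C), ∃ (B : D) (g : B ⟶ B₁), Gal (g ≫ f₁))
    (hfix : ∀ ⦃B C : D⦄ (f : B ⟶ C), Gal f → ∀ x : d.fld B,
      (∀ σ : B ⟶ B, σ ≫ f = f → (d.base.map σ).alg x = x) → ∃ x₀ : d.fld C, (d.base.map f).alg x₀ = x)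
    (hram : ∀ (C : D) (N : ℕ), 0 < N → ∃ (B : D) (f : B ⟶ C), ∀ a : OrdInt (d.fld C),
      ∃ b : OrdInt (d.fld B), ordIntMapOfHom (d.base.map f).alg (d.base.map f).isValHom a = b ^ N) :
    d.IsFieldwiseSaturated ↔
      (∀ (C : D) (x : d.Φ.obj (op C)) (n : ℕ), 0 < n →
          ∃ (B : D) (f : B ⟶ C) (y : d.Φ.obj (op B)), y ^ n = (d.Φ.map f.op).hom x) ∧
        (∀ ⦃B C : D⦄ (f : B ⟶ C), Gal f → ∀ b : d.B.obj (op B),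
          (∃ y : d.Φ.obj (op B), Frobenioids.divB d.Φ d.B d.divB (op B) b = Algebra.GrothendieckGroup.of y) →
          (∀ σ : B ⟶ B, σ ≫ f = f → (d.B.map σ.op).hom b = b) →
          ∃ c : d.B.obj (op C),
            (∃ z : d.Φ.obj (op C), Frobenioids.divB d.Φ d.B d.divB (op C) c = Algebra.GrothendieckGroup.of z) ∧
            (d.B.map f.op).hom c = b) :=
  ⟨fun hfs => ⟨d.divisible_of_isFieldwiseSaturated hfs hram,
      fun _ _ f hf b hb hinv => d.descent_of_isFieldwiseSaturated hfs Gal hfix f hf b hb hinv⟩,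
    fun h => d.isFieldwiseSaturated_of_divisible_of_descent Gal hdom h.1 h.2⟩

end Datum

end PadicFrd

end Literature.AlgebraicGeometry.Frobenioids

end
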